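import Summits.HodgeConjecture.HodgeConjecture.Theses.TateCuspKLift
import Literature.AlgebraicGeometry.HodgeTheory.LefschetzOneOneHolds

/-!
# Birth skeleton (BC3) of the crux `ArithmeticTateRestriction` (stmt-HodgeConjecture-9313),
# route `TateCuspKLift` — line `birth`: "graded piece, then K-gluing, then weight detection"

The crux K1 of the route: for a smooth projective `𝒳 → C` over a smooth projective curve, a point
`o ∈ C(ℂ)` whose scheme-theoretic fibre `X_o` is ℚ̄-TATE (the base change along some `σ : ℚ̄ → ℂ`
of a ℚ̄-scheme partitioned into finitely many locally closed split tori) and an ABSOLUTE HODGE class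
`ξ ∈ H²ᵖ(𝒳(ℂ); ℂ)`, the restriction `ξ|X_o` lies in
`PB^p(X_o) := ℂ-span {g^*a : g : X_o → Y, Y smooth projective, a ∈ algebraicClasses Y p}`
(the typed stand-in for `ch_p(K₀(X_o) ⊗ ℚ) ⊗ ℂ`).  Intended proof (route file, item docstring):
`ξ|X_o` is a genuine weight-`2p` Hodge cycle of the mixed Hodge structure `H²ᵖ(X_o)`; its graded
piece `Gr^W_{2p}(ξ|X_o)` is a ℚ-combination of cycle classes of closures of strata; the extension
data below it (the `Ext¹_MT(F)`-obstructions of the weight dévissage, `F` a number field of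
definition) die because `ξ` is absolute Hodge (Hodge at every complex place) and Borel's regulator is
injective on `⊕_places`, `Ext²_MT(F) = 0` makes the obstruction theory complete, so a motivic
(`KH₀`) lift exists, and `K₀ ⊗ ℚ ↠ KH₀ ⊗ ℚ` in Adams weight `p` (snc-toric K-regularity) makes it an
honest `K₀`-class, i.e. an element of `PB^p(X_o)`.

The tree has no mixed Hodge structures of singular varieties, no motivic cohomology and no
algebraic K-theory, so the weight filtration is rendered through its one typable shadow — PULL-BACKS
TO SMOOTH PROJECTIVE TEST VARIETIES `h : Y → X_o` (Deligne, Hodge III, 8.2.5: for `X_o` proper the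
joint kernel of all such `h^*` on `Hᵏ(X_o; ℚ)` is `W_{k-1}`).  Along this seam the intended proof is
exactly three statements:

  STUB 1 `stub_weightDetection` (Deligne 1974 + strictness; unconditional, known in print) — on the
    projective fibre `X_o`, a class PULLED BACK FROM smooth projective varieties (an element of
    `T(X_o) := span {g^*b}` — e.g. `ξ|X_o = (fiberι)^*ξ`, or any element of `PB^p(X_o)`) that dies
    on EVERY smooth projective test variety mapping to `X_o` is zero: `T(X_o)` is a sum of images of
    pure weight-`2p` structures, hence meets `W_{2p-1} ⊗ ℂ = ⋂ ker h^*` trivially.  This is the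
    "by strictness its realisation IS `ξ|X_o`" step of the item docstring: a Hodge cycle on `X_o` is
    determined by its graded piece.
  STUB 2 `stub_tatePullbacksAlgebraic` (Totaro 2014 / Bondarko weight complex; the "`Gr^W_{2p}` is a
    combination of strata classes" step) — on a ℚ̄-Tate projective fibre EVERY class of `H²ᵖ(X_o; ℂ)`
    becomes ALGEBRAIC on every smooth projective test variety `h : Y → X_o`: the Chow weight complex
    of a Tate variety is a complex of Tate motives, so `Gr^W_{2p} H²ᵖ(X_o) → H²ᵖ(Y)` is induced by
    morphisms of Chow motives `h(Y) → 𝟙(-p)`, i.e. by algebraic cycles on `Y`.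
  STUB 3 `stub_absoluteHodgeKGluing` (THE HEART = the route's foreseen `MotivicLift` +
    `SncToricKRegularity`, card (G)/(M3)) — given that `ξ` is absolute Hodge on the total space and
    that its restriction is componentwise algebraic (the output of STUB 2), there is an honest
    K-class `v ∈ PB^p(X_o)` with THE SAME PULL-BACK as `ξ|X_o` to every smooth projective test
    variety — the componentwise-algebraic boundary datum glues to one vector-bundle class exactly
    when the higher differentials ("Milnor flux") of the descent spectral sequence vanish, which is
    what `Ext²_MT(F) = 0` + Borel + absolute Hodge deliver, and `K₀` (not `KH₀`) is the K-regularity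
    bet.  HC-safe: implied by the crux (`arithmeticTateRestriction_kGluing`, proved below, `v := ξ|X_o`).

and the crux follows: STUB 3 gives `v`, STUB 2 feeds its hypothesis, and STUB 1 applied to
`ξ|X_o - v ∈ T(X_o)` gives `ξ|X_o = v ∈ PB^p(X_o)` (`ArithmeticTateRestriction_of`, kernel-checked,
no `sorry`).  The cut is tight and not a costume: STUB 1 and STUB 2 carry no absolute-Hodge /
arithmetic content and do not mention `PB`; STUB 3 alone does not give the crux (it only pins
`ξ|X_o` down up to `⋂ ker h^*`, which is `W_{2p-1} ≠ 0` on a singular fibre); none of the three is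
provable from or equivalent to the crux or the summit by the cheap tactics (BC3 probes, `Lines/birth.md`).

## Contents

* `pulledBackAlgebraicClasses X p` — `PB^p(X)`, the crux's inline span VERBATIM (so that
  `v ∈ pulledBackAlgebraicClasses (fiberOver f o) p` is definitionally the crux's conclusion);
  `pulledBackClasses X k` — `T^k(X)`, all classes pulled back from smooth projective varieties;
  `IsQbarTate X` — the crux's ℚ̄-Tate clause VERBATIM as a predicate.
* the three registered stubs (`sorry` ONLY there) and `ArithmeticTateRestriction_of` — the
  composition stub₁ → stub₂ → stub₃ → the crux BY NAME
  (`Summit.HodgeConjecture.HodgeConjecture.Theses.TateCuspKLift.ArithmeticTateRestriction`);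
  `ArithmeticTateRestriction_of_stubs` — the crux modulo exactly the three stubs.
* PROVED sanity: `pulledBackAlgebraicClasses_le_pulledBackClasses`, `restrict_mem_pulledBackClasses`
  (the two membership facts the composition uses) and `arithmeticTateRestriction_kGluing` (the crux
  implies the heart: STUB 3 is not stronger than the crux, hence HC-safe with it);
  `arithmeticTateRestriction_of_hodgeConjecture` (the summit implies the crux, in its unfolded
  spelling: HC-safety, as the refuters recorded — `Y := 𝒳`, `g := fiberι f o`, `a := ξ`).
* PROVED special cases (BC5, unconditional, no `sorry`): `arithmeticTateRestriction_codimOne` — the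
  crux for `p = 1` on ANY fibre (Lefschetz `(1,1)`, tree theorem `lefschetzOneOne_rational_holds`);
  `arithmeticTateRestriction_dimLEThree` — the crux for total spaces of dimension `N ≤ 3` (tree
  theorem `hodgeClasses_algebraic_of_dim_le_three_holds`).  The definitions compute and the crux is
  inhabited in kind; its first open instances are `p = 2` on fourfold total spaces.

Disproof used: none on file — `Cruxes/ArithmeticTateRestriction/` had no `Disproof.lean`, no
`_false_without_` theorem and no landed `Negative/` lemma at registration (`ledger crux ls`: no
workfiles; `ledger negatives --problem HodgeConjecture` consulted).
-/

noncomputable section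

namespace Summit.HodgeConjecture.HodgeConjecture.Cruxes.ArithmeticTateRestriction.Birth

open CategoryTheory
open Literature.AlgebraicGeometry.Motives Literature.AlgebraicGeometry.HodgeTheory
open Summit.HodgeConjecture.HodgeConjecture.Theses.TateCuspKLift (ArithmeticTateRestriction)

/-! ### The typable carriers -/

/-- `PB^p(X)`, the **pulled-back algebraic classes** of codimension `p` on a complex scheme `X`:
the `ℂ`-span of the pull-backs `g^*a` of algebraic classes `a ∈ algebraicClasses Y p` along
`ℂ`-morphisms `g : X ⟶ Y` to smooth projective varieties `Y` — the crux's inline conclusion,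
verbatim (typed stand-in for `ch_p(K₀(X) ⊗ ℚ) ⊗ ℂ`: vector bundles are Grassmannian pull-backs
after an ample twist; conversely `g^*cl(Z) = ch_p(g^*u)` by Grothendieck–Riemann–Roch).
[cite: Arapura2016SingularLefschetz, §8 Lemma 8.6] [cite: Fulton1998, §15.2 (GRR)] -/
def pulledBackAlgebraicClasses (X : SchemeOver ℂ) (p : ℕ) :
    Submodule ℂ (complexBetti X (2 * p)) :=
  Submodule.span ℂ {c : complexBetti X (2 * p) | ∃ (m : ℕ) (Y : SchemeOver ℂ)
    (_ : IsSmoothProjective m Y) (g : X ⟶ Y) (a : complexBetti Y (2 * p)),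
    a ∈ algebraicClasses Y p ∧ c = (complexBetti.map g (2 * p)).hom a}

/-- `Tᵏ(X)`, the classes of `Hᵏ(X(ℂ); ℂ)` **pulled back from smooth projective varieties**: the
`ℂ`-span of all `g^*b`, `g : X ⟶ Y` a `ℂ`-morphism to a smooth projective `Y`, `b ∈ Hᵏ(Y(ℂ); ℂ)`
arbitrary.  It contains the restrictions of ambient classes (`g = fiberι f o`, `Y = 𝒳`) and
`PB^p(X)`; Hodge-theoretically it is a finite sum of images of PURE weight-`k` structures, hence
meets `W_{k-1}Hᵏ(X) ⊗ ℂ` trivially (strictness). [cite: DeligneHodgeIII1974, Thm. 8.2.4, Prop. 8.2.5] -/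
def pulledBackClasses (X : SchemeOver ℂ) (k : ℕ) : Submodule ℂ (complexBetti X k) :=
  Submodule.span ℂ {c : complexBetti X k | ∃ (m : ℕ) (Y : SchemeOver ℂ)
    (_ : IsSmoothProjective m Y) (g : X ⟶ Y) (b : complexBetti Y k),
    c = (complexBetti.map g k).hom b}

/-- `X/ℂ` is **ℚ̄-Tate** (the crux's hypothesis on the fibre, verbatim): `X` is isomorphic over `ℂ`
to the base change along some `σ : ℚ̄ →+* ℂ` of a ℚ̄-scheme `X₁` admitting a finite partition into
locally closed split tori `Spec ℚ̄[ℤ^{bᵢ}] ↪ X₁` (immersions with pairwise disjoint, jointly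
covering images).  Affine pavings and snc unions of split toric varieties glued along
torus-invariant strata qualify. [cite: Totaro2014ChowLinear, §1 (linear schemes)] -/
def IsQbarTate (X : SchemeOver ℂ) : Prop :=
  ∃ (X₁ : SchemeOver (AlgebraicClosure ℚ)) (σ : AlgebraicClosure ℚ →+* ℂ)
    (_ : X ≅ (baseChangeHom σ).obj X₁) (ι : Type) (_ : Finite ι) (b : ι → ℕ)
    (e : ∀ i : ι, specOver (AlgebraicClosure ℚ)
      (AddMonoidAlgebra (AlgebraicClosure ℚ) (Fin (b i) →₀ ℤ)) ⟶ X₁),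
    (∀ i, AlgebraicGeometry.IsImmersion (e i).left) ∧
    (Pairwise fun i j => Disjoint (Set.range fun x => (e i).left.base x)
      (Set.range fun x => (e j).left.base x)) ∧
    (⋃ i, Set.range fun x => (e i).left.base x) = Set.univ

/-- `PB^p(X) ⊆ T^{2p}(X)`: a pulled-back algebraic class is a pulled-back class. [folklore] -/
theorem pulledBackAlgebraicClasses_le_pulledBackClasses (X : SchemeOver ℂ) (p : ℕ) :
    pulledBackAlgebraicClasses X p ≤ pulledBackClasses X (2 * p) := by
  refine Submodule.span_mono ?_
  rintro c ⟨m, Y, hY, g, a, -, rfl⟩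
  exact ⟨m, Y, hY, g, a, rfl⟩

/-- The restriction `ξ|X_o = (fiberι f o)^* ξ` of an ambient class of the smooth projective total
space is a pulled-back class on the fibre (`g := fiberι f o`, `Y := 𝒳`). [folklore] -/
theorem restrict_mem_pulledBackClasses {N k : ℕ} {𝒳 C : SchemeOver ℂ} (h𝒳 : IsSmoothProjective N 𝒳)
    (f : 𝒳 ⟶ C) (o : AlgPoints C ℂ) (ξ : complexBetti 𝒳 k) :
    (complexBetti.map (fiberι f o) k).hom ξ ∈ pulledBackClasses (fiberOver f o) k :=
  Submodule.subset_span ⟨N, 𝒳, h𝒳, fiberι f o, ξ, rfl⟩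

/-! ### The three registered stubs -/

/-- STUB 1 (known in print, unconditional; L on this tree — it needs the mixed Hodge structure on
the cohomology of a projective variety) — **weight detection: on a projective fibre, a class pulled
back from smooth projective varieties that dies on every smooth projective test variety is zero.**
For `X_o` proper, `W_{k-1}Hᵏ(X_o; ℚ) = ker (Hᵏ(X_o) → Hᵏ(X̃))` for any proper surjection from a
smooth `X̃` (Deligne, Hodge III, Prop. 8.2.5; take the resolutions of the irreducible components of
`(X_o)_red`, each a smooth projective — geometrically irreducible — test variety), so
`⋂_{Y,h} ker h^* = W_{2p-1} ⊗ ℂ`; and `T^{2p}(X_o)` is a finite sum of images of morphisms of mixed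
Hodge structures from PURE weight-`2p` structures `H²ᵖ(Y_j)`, which by strictness meets `W_{2p-1}`
in `0` (Thm. 8.2.4 / 2.3.5).  The fibre `X_o = fiberOver f o` of the projective `𝒳` over the
ℂ-point `o` of the separated `C` is a closed subscheme of `𝒳`, hence projective; the empty fibre is
harmless (`H = 0`).  Why it might fail: it does not in print; on the tree it waits for Deligne's
mixed Hodge theory of complete singular varieties (weight filtration via a smooth proper
hypercover / resolutions) — none of it is formalised.
[cite: DeligneHodgeIII1974, Prop. 8.2.5, Thm. 8.2.4] [cite: PetersSteenbrink2008, Thm. 5.39, Cor. 5.42] -/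
theorem stub_weightDetection :
    ∀ (N p : ℕ) (𝒳 C : SchemeOver ℂ) (f : 𝒳 ⟶ C) (o : AlgPoints C ℂ),
      IsSmoothProjective N 𝒳 → IsSmoothProjective 1 C →
      ∀ u ∈ pulledBackClasses (fiberOver f o) (2 * p),
        (∀ (m : ℕ) (Y : SchemeOver ℂ), IsSmoothProjective m Y → ∀ h : Y ⟶ fiberOver f o,
          (complexBetti.map h (2 * p)).hom u = 0) →
        u = 0 := by
  sorry

/-- STUB 2 (the graded-piece step; M–L, known in print for linear / affinely paved / snc-toric
fibres) — **on a ℚ̄-Tate projective fibre every class becomes algebraic on every smooth projective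
test variety.**  `h^* : H²ᵖ(X_o) → H²ᵖ(Y)` kills `W_{2p-1}` (the target is pure) and factors
through `Gr^W_{2p}H²ᵖ(X_o)`, which is computed by the Gillet–Soulé / Bondarko weight complex of
`X_o`; for a variety with a finite partition into split tori (`M^c(X_o)` mixed Tate: localisation
triangles; Totaro's linear schemes) the weight complex is a complex of pure TATE Chow motives
`⊕ 𝟙(-a)`, so `Gr^W_{2p}H²ᵖ(X_o) → H²ᵖ(Y)` is induced by morphisms of Chow motives `h(Y) → 𝟙(-p)`,
i.e. by codimension-`p` algebraic cycles on `Y`: its image is spanned by cycle classes, which lie in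
`algebraicClasses Y p = Nᵖ H²ᵖ(Y)` (a cycle class is supported on its cycle).  For the snc-toric /
affinely paved fibres of the application this is "`Gr^W_{2p}(ξ|X_o)` is a ℚ-combination of cycle
classes of closures of strata" (item docstring) read on the components.  No absolute-Hodge or
arithmetic input.  Why it might fail: the crux's Tate clause allows ANY finite partition into
locally closed tori, with no frontier (filtrability) condition; `[X_o] ∈ ℤ[𝕃] ⊂ K₀(Var)` always,
but "`M^c(X_o)` mixed Tate" is proved in print for filtrable decompositions (affine pavings,
snc-toric unions, linear schemes built by cut-and-paste) — an exotic non-filtrable torus partition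
with a non-Tate graded piece would break this stub (and, harder, the route's `M(X₁) ∈ DMT(F)`).
[cite: Totaro2014ChowLinear, Thm. 4.1 and §5 (weight complex of linear schemes)]
[cite: GilletSoule1996, Thm. 2 (weight complex)] [cite: Fulton1998, §19.1 (cycle classes)] -/
theorem stub_tatePullbacksAlgebraic :
    ∀ (N p : ℕ) (𝒳 C : SchemeOver ℂ) (f : 𝒳 ⟶ C) (o : AlgPoints C ℂ),
      IsSmoothProjective N 𝒳 → IsSmoothProjective 1 C → IsQbarTate (fiberOver f o) →
      ∀ (u : complexBetti (fiberOver f o) (2 * p)) (m : ℕ) (Y : SchemeOver ℂ),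
        IsSmoothProjective m Y → ∀ h : Y ⟶ fiberOver f o,
          (complexBetti.map h (2 * p)).hom u ∈ algebraicClasses Y p := by
  sorry

/-- STUB 3 (THE HEART; open — the route's foreseen `MotivicLift` + `SncToricKRegularity`, card
(G)/(M3), in typable form) — **absolute-Hodge K-gluing: on a ℚ̄-Tate fibre, the restriction of an
ABSOLUTE HODGE class whose pull-backs to all smooth projective test varieties are algebraic has the
same test-variety pull-backs as an honest K-class `v ∈ PB^p(X_o)`.**  Intended proof: descend
`X₁` and its torus partition to a number field `F`; `M(X₁) ∈ DMT(F)` carries the motivic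
`t`-structure with `Ext²_MT(F) = 0`, `Ext¹_MT(F)(ℚ(0), ℚ(j)) = K_{2j-1}(F)_ℚ` (Deligne–Goncharov
§§1–2), so the componentwise-algebraic datum (a `Hom_MT(ℚ(-p), Gr^W_{2p})` element, canonically
`F`-rational) lifts to `H²ᵖ_M(X₁, ℚ(p))` iff a sequence of `Ext¹` classes vanishes; their Hodge
realisations vanish at EVERY complex place `τ ∘ σ` because the conjugate `ξ^τ` is again a Hodge
class restricting to `X_o^τ` (absolute Hodge), and Borel's regulator is injective on `⊕_places`
(`j ≥ 2`; units at `j = 1`) — so a `KH₀`-lift exists, its realisation has the pull-backs of `ξ|X_o`,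
and `K₀(X_o) ⊗ ℚ ↠ KH₀(X_o) ⊗ ℚ` in Adams weight `p` (snc unions of smooth projective toric
varieties; Anderson–Payne / CHWW for one toric variety) turns it into a vector-bundle class, i.e. an
element of `PB^p(X_o)` (Grassmannians + GRR).  This stub is where the line USES the absolute Hodge
hypothesis and the ℚ̄-structure; it is implied by the crux (`arithmeticTateRestriction_kGluing`),
hence HC-safe with it.  Why it might fail: (i) the `K₀`-vs-`KH₀` step — `K₀ ⊗ ℚ → KH₀ ⊗ ℚ` can
miss weight-`2p` Hodge cycles on non-snc Tate singularities (Barbieri-Viale–Srinivas cuspidal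
surface, `p = 1`) and K-regularity in Adams degree `p` for snc-toric unions is unproved; (ii) each
`Ext¹` step of the weight dévissage must be `F`-rational for Borel to apply; (iii) over `ℂ` instead
of `ℚ̄` the statement meets the Milnor-flux species `d₃ ∈ K₂(ℂ) ⊗ H³(Γ)` (route item 9609).
[cite: DeligneGoncharov2005, §§1–2] [cite: Borel1977, Thm. 2 (regulator injectivity)]
[cite: Arapura2016SingularLefschetz, Conj. 8.1, Prop. 8.3, Lemma 8.6]
[cite: AndersonPayne2013OperationalK, Rem. 1.4 and 5.11 (arXiv:1301.0425)]
[cite: BarbieriVialeSrinivas1994NS, §1] -/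
theorem stub_absoluteHodgeKGluing :
    ∀ (N p : ℕ) (𝒳 C : SchemeOver ℂ) (f : 𝒳 ⟶ C) (o : AlgPoints C ℂ),
      IsSmoothProjective N 𝒳 → IsSmoothProjective 1 C → IsQbarTate (fiberOver f o) →
      ∀ ξ : complexBetti 𝒳 (2 * p), IsAbsoluteHodgeClass N 𝒳 p ξ →
        (∀ (m : ℕ) (Y : SchemeOver ℂ), IsSmoothProjective m Y → ∀ h : Y ⟶ fiberOver f o,
          (complexBetti.map h (2 * p)).hom ((complexBetti.map (fiberι f o) (2 * p)).hom ξ) ∈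
            algebraicClasses Y p) →
        ∃ v ∈ pulledBackAlgebraicClasses (fiberOver f o) p,
          ∀ (m : ℕ) (Y : SchemeOver ℂ), IsSmoothProjective m Y → ∀ h : Y ⟶ fiberOver f o,
            (complexBetti.map h (2 * p)).hom v =
              (complexBetti.map h (2 * p)).hom ((complexBetti.map (fiberι f o) (2 * p)).hom ξ) := by
  sorry

/-! ### The composition: stub₁ → stub₂ → stub₃ → the crux, by name -/

/-- **THE LINE'S COMPOSITION** (kernel-checked, no `sorry`): weight detection (STUB 1), Tate
pull-backs algebraic (STUB 2) and absolute-Hodge K-gluing (STUB 3) imply the crux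
`ArithmeticTateRestriction`: STUB 3 (fed by STUB 2) gives `v ∈ PB^p(X_o)` with the same pull-backs
as `ξ|X_o` to every smooth projective test variety; `ξ|X_o - v` is a pulled-back class
(`restrict_mem_pulledBackClasses`, `pulledBackAlgebraicClasses_le_pulledBackClasses`) dying on every
test variety, hence zero by STUB 1; so `ξ|X_o = v ∈ PB^p(X_o)`. [folklore] -/
theorem ArithmeticTateRestriction_of :
    (∀ (N p : ℕ) (𝒳 C : SchemeOver ℂ) (f : 𝒳 ⟶ C) (o : AlgPoints C ℂ),
      IsSmoothProjective N 𝒳 → IsSmoothProjective 1 C →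
      ∀ u ∈ pulledBackClasses (fiberOver f o) (2 * p),
        (∀ (m : ℕ) (Y : SchemeOver ℂ), IsSmoothProjective m Y → ∀ h : Y ⟶ fiberOver f o,
          (complexBetti.map h (2 * p)).hom u = 0) →
        u = 0) →
    (∀ (N p : ℕ) (𝒳 C : SchemeOver ℂ) (f : 𝒳 ⟶ C) (o : AlgPoints C ℂ),
      IsSmoothProjective N 𝒳 → IsSmoothProjective 1 C → IsQbarTate (fiberOver f o) →
      ∀ (u : complexBetti (fiberOver f o) (2 * p)) (m : ℕ) (Y : SchemeOver ℂ),
        IsSmoothProjective m Y → ∀ h : Y ⟶ fiberOver f o,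
          (complexBetti.map h (2 * p)).hom u ∈ algebraicClasses Y p) →
    (∀ (N p : ℕ) (𝒳 C : SchemeOver ℂ) (f : 𝒳 ⟶ C) (o : AlgPoints C ℂ),
      IsSmoothProjective N 𝒳 → IsSmoothProjective 1 C → IsQbarTate (fiberOver f o) →
      ∀ ξ : complexBetti 𝒳 (2 * p), IsAbsoluteHodgeClass N 𝒳 p ξ →
        (∀ (m : ℕ) (Y : SchemeOver ℂ), IsSmoothProjective m Y → ∀ h : Y ⟶ fiberOver f o,
          (complexBetti.map h (2 * p)).hom ((complexBetti.map (fiberι f o) (2 * p)).hom ξ) ∈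
            algebraicClasses Y p) →
        ∃ v ∈ pulledBackAlgebraicClasses (fiberOver f o) p,
          ∀ (m : ℕ) (Y : SchemeOver ℂ), IsSmoothProjective m Y → ∀ h : Y ⟶ fiberOver f o,
            (complexBetti.map h (2 * p)).hom v =
              (complexBetti.map h (2 * p)).hom ((complexBetti.map (fiberι f o) (2 * p)).hom ξ)) →
    ArithmeticTateRestriction := by
  intro h₁ h₂ h₃ N p 𝒳 C f o h𝒳 hC hT ξ hξ
  obtain ⟨v, hv, hpull⟩ := h₃ N p 𝒳 C f o h𝒳 hC hT ξ hξ
    (fun m Y hY h ↦ h₂ N p 𝒳 C f o h𝒳 hC hT _ m Y hY h)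
  have hmem : (complexBetti.map (fiberι f o) (2 * p)).hom ξ - v ∈
      pulledBackClasses (fiberOver f o) (2 * p) :=
    Submodule.sub_mem _ (restrict_mem_pulledBackClasses h𝒳 f o ξ)
      (pulledBackAlgebraicClasses_le_pulledBackClasses _ _ hv)
  have hzero : (complexBetti.map (fiberι f o) (2 * p)).hom ξ - v = 0 :=
    h₁ N p 𝒳 C f o h𝒳 hC _ hmem (fun m Y hY h ↦ by rw [map_sub, hpull m Y hY h, sub_self])
  rw [sub_eq_zero] at hzero
  rw [hzero]
  exact hv

/-- **The crux, closed modulo exactly the three registered stubs.** -/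
theorem ArithmeticTateRestriction_of_stubs : ArithmeticTateRestriction :=
  ArithmeticTateRestriction_of stub_weightDetection stub_tatePullbacksAlgebraic
    stub_absoluteHodgeKGluing

/-! ### Proved sanity: the heart is implied by the crux (tightness, no costume) -/

/-- **The crux implies the heart (PROVED)**: `ArithmeticTateRestriction` gives STUB 3 with
`v := ξ|X_o` itself.  So STUB 3 is not stronger than the crux (in particular it is HC-safe with
it), and together with STUBS 1–2 it is equivalent to the crux — the line isolates in STUB 3 exactly
the arithmetic K-gluing, modulo two classical Hodge-theoretic statements. [folklore] -/
theorem arithmeticTateRestriction_kGluing (hK : ArithmeticTateRestriction) :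
    ∀ (N p : ℕ) (𝒳 C : SchemeOver ℂ) (f : 𝒳 ⟶ C) (o : AlgPoints C ℂ),
      IsSmoothProjective N 𝒳 → IsSmoothProjective 1 C → IsQbarTate (fiberOver f o) →
      ∀ ξ : complexBetti 𝒳 (2 * p), IsAbsoluteHodgeClass N 𝒳 p ξ →
        (∀ (m : ℕ) (Y : SchemeOver ℂ), IsSmoothProjective m Y → ∀ h : Y ⟶ fiberOver f o,
          (complexBetti.map h (2 * p)).hom ((complexBetti.map (fiberι f o) (2 * p)).hom ξ) ∈
            algebraicClasses Y p) →
        ∃ v ∈ pulledBackAlgebraicClasses (fiberOver f o) p,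
          ∀ (m : ℕ) (Y : SchemeOver ℂ), IsSmoothProjective m Y → ∀ h : Y ⟶ fiberOver f o,
            (complexBetti.map h (2 * p)).hom v =
              (complexBetti.map h (2 * p)).hom ((complexBetti.map (fiberι f o) (2 * p)).hom ξ) :=
  fun N p 𝒳 C f o h𝒳 hC hT ξ hξ _ ↦ ⟨_, hK N p 𝒳 C f o h𝒳 hC hT ξ hξ, fun _ _ _ _ ↦ rfl⟩

/-! ### Proved: HC-safety and two unconditional special cases (BC5) -/

/-- The restriction of an ambient ALGEBRAIC class lies in `PB^p(X_o)` (`Y := 𝒳`, `g := fiberι f o`,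
`a := ξ`) — the one-line mechanism behind the HC-safety of the crux. [folklore] -/
theorem restrict_mem_pulledBackAlgebraicClasses {N p : ℕ} {𝒳 C : SchemeOver ℂ}
    (h𝒳 : IsSmoothProjective N 𝒳) (f : 𝒳 ⟶ C) (o : AlgPoints C ℂ) {ξ : complexBetti 𝒳 (2 * p)}
    (hξ : ξ ∈ algebraicClasses 𝒳 p) :
    (complexBetti.map (fiberι f o) (2 * p)).hom ξ ∈ pulledBackAlgebraicClasses (fiberOver f o) p :=
  Submodule.subset_span ⟨N, 𝒳, h𝒳, fiberι f o, ξ, hξ, rfl⟩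

/-- **HC-safety (PROVED)**: the Hodge conjecture implies the crux — an absolute Hodge class is a
rational `(p,p)` class, algebraic on `𝒳` under HC, and restrictions of ambient algebraic classes lie
in `PB^p(X_o)`.  So neither the crux nor STUB 3 can be refuted short of a counterexample to HC; the
risk of the line is hardness, concentrated in STUB 3. [cite: Deligne2000, §1] -/
theorem arithmeticTateRestriction_of_hodgeConjecture (hHC : _root_.HodgeConjecture) :
    ∀ (N p : ℕ) (𝒳 C : SchemeOver ℂ) (f : 𝒳 ⟶ C) (o : AlgPoints C ℂ),
      IsSmoothProjective N 𝒳 → IsSmoothProjective 1 C → IsQbarTate (fiberOver f o) →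
      ∀ ξ : complexBetti 𝒳 (2 * p), IsAbsoluteHodgeClass N 𝒳 p ξ →
        (complexBetti.map (fiberι f o) (2 * p)).hom ξ ∈
          pulledBackAlgebraicClasses (fiberOver f o) p :=
  fun _N p _𝒳 _C f o h𝒳 _ _ ξ hξ ↦
    restrict_mem_pulledBackAlgebraicClasses h𝒳 f o
      ((hHC h𝒳).2 p ξ hξ.isRationalClass hξ.isOfHodgeType)

/-- … and that unfolded statement IS the crux (definitional unfolding of `PB^p` and `IsQbarTate`;
stated as an `example` so that the only theorems concluding the crux BY NAME are the skeleton's). -/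
example (hHC : _root_.HodgeConjecture) : ArithmeticTateRestriction :=
  arithmeticTateRestriction_of_hodgeConjecture hHC

/-- **BC5 special case `p = 1` (PROVED, unconditional)**: the crux in codimension one, on ANY fibre —
an absolute Hodge class in `H²` is a rational `(1,1)` class, hence algebraic on `𝒳` by the
Lefschetz theorem on `(1,1)`-classes (tree theorem `lefschetzOneOne_rational_holds`, Kodaira–Serre +
GAGA), and its restriction is a pulled-back algebraic class.  (This is also why the
Barbieri-Viale–Srinivas `K₀`-vs-`KH₀` gap in `p = 1` does not touch the typed crux.)
[cite: VoisinHodgeI2002, Thm. 11.30] -/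
theorem arithmeticTateRestriction_codimOne :
    ∀ (N : ℕ) (𝒳 C : SchemeOver ℂ) (f : 𝒳 ⟶ C) (o : AlgPoints C ℂ),
      IsSmoothProjective N 𝒳 → IsSmoothProjective 1 C → IsQbarTate (fiberOver f o) →
      ∀ ξ : complexBetti 𝒳 (2 * 1), IsAbsoluteHodgeClass N 𝒳 1 ξ →
        (complexBetti.map (fiberι f o) (2 * 1)).hom ξ ∈
          pulledBackAlgebraicClasses (fiberOver f o) 1 :=
  fun _N _𝒳 _C f o h𝒳 _ _ ξ hξ ↦
    restrict_mem_pulledBackAlgebraicClasses h𝒳 f o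
      (lefschetzOneOne_rational_holds h𝒳 ξ hξ.isRationalClass hξ.isOfHodgeType)

/-- **BC5 special case `dim 𝒳 ≤ 3` (PROVED, unconditional)**: the crux for total spaces of
dimension `N ≤ 3`, every `p` — the Hodge conjecture holds on `𝒳` (tree theorem
`hodgeClasses_algebraic_of_dim_le_three_holds`: Lefschetz `(1,1)` + hard Lefschetz), so `ξ` is
algebraic on `𝒳` and restricts into `PB^p(X_o)`.  First open instances of the crux: `p = 2` on
fourfold total spaces (e.g. pencils of threefolds degenerating to a ℚ̄-Tate fibre).
[cite: VoisinHodgeII2003, §10.2.3 proof of Prop. 10.26] -/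
theorem arithmeticTateRestriction_dimLEThree :
    ∀ (N p : ℕ) (𝒳 C : SchemeOver ℂ) (f : 𝒳 ⟶ C) (o : AlgPoints C ℂ), N ≤ 3 →
      IsSmoothProjective N 𝒳 → IsSmoothProjective 1 C → IsQbarTate (fiberOver f o) →
      ∀ ξ : complexBetti 𝒳 (2 * p), IsAbsoluteHodgeClass N 𝒳 p ξ →
        (complexBetti.map (fiberι f o) (2 * p)).hom ξ ∈
          pulledBackAlgebraicClasses (fiberOver f o) p :=
  fun _N p _𝒳 _C f o hN h𝒳 _ _ ξ hξ ↦
    restrict_mem_pulledBackAlgebraicClasses h𝒳 f o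
      (hodgeClasses_algebraic_of_dim_le_three_holds hN h𝒳 p ξ hξ.isRationalClass hξ.isOfHodgeType)

end Summit.HodgeConjecture.HodgeConjecture.Cruxes.ArithmeticTateRestriction.Birth

end
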